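import Summits.BirchSwinnertonDyer.BirchSwinnertonDyer.Theorems.SchneiderFreeAdditiveX3AnticycControlAdditiveBaseCountExactAnyTorsion
import Summits.BirchSwinnertonDyer.BirchSwinnertonDyer.Theorems.SchneiderFreeAdditiveX3AnticycControlAdditiveCruxOfBaseCountTors
import Summits.BirchSwinnertonDyer.BirchSwinnertonDyer.Theorems.SchneiderFreeAdditiveX3AnticycControlAdditiveTorsionExponents
import Summits.BirchSwinnertonDyer.BirchSwinnertonDyer.Theorems.SchneiderFreeAdditiveX3AnticyclotomicTowerTorsion
import Summits.BirchSwinnertonDyer.BirchSwinnertonDyer.Theorems.SchneiderFreeAdditiveX3AnticycControlAdditiveLocalKernelAtP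
import Summits.BirchSwinnertonDyer.BirchSwinnertonDyer.Theorems.SchneiderFreeAdditiveX3AnticycControlAdditiveOfTorsAtoms
import Summits.BirchSwinnertonDyer.BirchSwinnertonDyer.Theorems.SchneiderFreeAdditiveX3AnticycControlAdditiveStubNoLocalPTorsionOfAtoms
import Summits.BirchSwinnertonDyer.Rank1Residual.X11b.LocalPrimaryCohomologyEP
import Summits.BirchSwinnertonDyer.BirchSwinnertonDyer.Theses.SchneiderFreeAdditiveX3
import HarnessLib

/-!
# Route `SchneiderFreeAdditiveX3`, item `ControlGlobalPTorsionF` (stmt-BirchSwinnertonDyer-19547) — CLOSED: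
# regime B2 of the control corner (the frames WITH global `p`-torsion)

Seat `bsd-schneider-door-c4`, gen 3 (cell `bsd-schneider-ideate`). The control corner of the K1 door (board
row B6 ∩ X3 ∩ sst-twist, `r = 1`; served crux `AnticycControlAdditiveKF`, skeleton v4-KF) splits the frames
by local/global `p`-torsion: regime A (item 19544, CLOSED), regime B1 (item 19545, CLOSED), Fin_v (item
19546) and regime B2 = THIS item: the anticyclotomic control EQUALITY `SchneiderFree.AdditiveControlOnTreeAt`
at the frames with `E(K)[p] ≠ 0` (`p = 3`, the `3`-torsion members of 64.4 % of the door's `p = 3` X3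
classes), GIVEN Fin_v on the cell, under the four cite-only facts of `ControlFacts` + Kolyvagin.

The mathematics is the torsion-general exact base count (P6-add-tors)
(`additiveBaseSelmerCountTors_of_rankOne_anyTorsion`, file `…BaseCountExactAnyTorsion.lean`:
`#Sel_𝔭 · #E(ℚ_p)[p^∞] = p^a`, `a = ord_p #Ш + 2(ord_p log_ω P − ord_p idx) + ord_p ∏_{w∣p} c_w + g`, `p^g = #E(K)[p^∞]`),
fed with `t = t_p` (Fin_v + Brink Cor. 1, door-c4 gen 2 `natCard_localKer_eq_pow_of_finite`),
`p^g = #ker res` (door-c4 gen 0 `natCard_ker_resOfLe_top_eq_natCard_fixedPoints` + door-c5's finiteness of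
`E(K_∞^{ac})[p^∞]` + Galois descent), door-c6's datum-level (P9-𝓒) `stub_ptSurj_of_poitouTate` and (L10)
`stub_coinv_of_poitouTate`, and Brink's (P11), into door-c4 gen 0's glue `additiveControlOnTreeAt_of_torsAtoms`
— whose `g` and `t` CANCEL: the typed equality has no torsion term (Keller–Yin App. B Thm. B.0.6's count at a
semistable prime, here at an additive one). Also lands the registered stub `stub_regimeB2` (by name) of the
v4-KF skeleton of crux `AnticycControlAdditiveKF` (stmt-BirchSwinnertonDyer-19548). CONDITIONAL on the cited
facts carried INSIDE the item's statement; closes nothing about BSD by itself.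

References: [JetchevSkinnerWan2017] §3.2–3.3, Thm. 3.3.1; [KellerYin2024] App. B Thm. B.0.6 (arXiv:2402.12781);
[Castella2018] Thm. 2.3; [MilneADT2006] I 2.8, 4.10; [Brink2007] Thm. 2, Cor. 1; [Kolyvagin1990] Thm. A;
[GreenbergLNM1716] §3 Lemma 3.3, §5 Prop. 5.8.
-/

noncomputable section

open scoped Classical

open Field NumberField IsDedekindDomain WeierstrassCurve
open Literature.NumberTheory.EllipticCurves Literature.NumberTheory.EllipticCurves.GreenbergSelmer
open Literature.NumberTheory.GaloisRepresentations
open Literature.NumberTheory.GaloisCohomology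
open Literature.NumberTheory.EllipticCurves.ModularForms
  Literature.NumberTheory.EllipticCurves.Rank1Residual
  Literature.NumberTheory.EllipticCurves.Rank1Residual.Typed
  Summit.BirchSwinnertonDyer.Rank1Residual
  Summit.BirchSwinnertonDyer.Rank1Residual.X11b
  Summit.BirchSwinnertonDyer.Rank1Residual.X11b.AcSelmer
  Summit.BirchSwinnertonDyer.Rank1Residual.X11b.LocBridge

set_option linter.dupNamespace false

namespace Summit.BirchSwinnertonDyer.BirchSwinnertonDyer.Theorems.SchneiderFreeAdditiveX3

/-! ## §4. Item `ControlGlobalPTorsionF` (stmt-BirchSwinnertonDyer-19547): regime B2 of the control corner -/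

section RegimeB2

open Summit.BirchSwinnertonDyer.BirchSwinnertonDyer.Theses.SchneiderFreeAdditiveX3
  Summit.BirchSwinnertonDyer.BirchSwinnertonDyer.Theorems.SchneiderFree
  Summit.BirchSwinnertonDyer.BirchSwinnertonDyer.Theorems.SchneiderFreeControlAtoms

/-- **T-B6-2′ (`SchneiderFree.AdditiveControlOnTreeAt`) at EVERY frame of the door — any global `p`-torsion
`g`, any local `p`-torsion `t_p` — from the cited facts and Fin_v at the frame.** For `E/ℚ` globally
minimal, `p` odd additive, `K` imaginary quadratic with `p` split and `p ∤ #μ(K)`, `κ` anticyclotomic with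
topological generator `γ`, a degree-one `𝔭 ∋ p` that does not split completely in `K_∞` and at which
Fin_v holds, `rank E(K) = 1`, `Ш(E/K)` finite, `P` non-torsion, the route datum `(N, Dt, H, ι)` being
carried only to feed door-c6's datum-level (P9-𝓒)/(L10): gen 0's glue `additiveControlOnTreeAt_of_torsAtoms`
with `p^g = #ker res = #E_K[p^∞]^{Γ_K} = #E(K)[p^∞]` (door-c4 gen 0 + door-c5 + Galois descent),
`t = t_p` (door-c4 gen 2, from Fin_v + Brink Cor. 1), (P6-add-tors) at any `g`
(`additiveBaseSelmerCountTors_of_rankOne_anyTorsion`), (P9-𝓒) `stub_ptSurj_of_poitouTate` and (L10)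
`stub_coinv_of_poitouTate` (door-c6), (P11) Brink. CONDITIONAL (hypotheses BY NAME); BSD is not proved by
any of this. [cite: JetchevSkinnerWan2017, Thm. 3.3.1 (arXiv:1512.06894 p. 11)]
[cite: KellerYin2024, App. B Thm. B.0.6 (arXiv:2402.12781 pp. 29–30)] [cite: Castella2018, Thm. 2.3 (arXiv:1704.06608 p. 5)]
[cite: MilneADT2006, Ch. I, Thm. 4.10 and Thm. 2.8] [cite: Brink2007, Thm. 2 and Cor. 1] [cite: Kolyvagin1990, Thm. A] -/
theorem additiveControlOnTreeAt_anyTorsion_of_facts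
    (hPT : ∀ (K : Type) [Field K] [NumberField K], poitouTate_selmerStructure_duality K)
    (hPT2 : ∀ (K : Type) [Field K] [NumberField K], poitouTate_sha_tateDual K)
    (hBr : ∀ (K : Type) [Field K] [NumberField K] (p : ℕ) [Fact p.Prime],
      ZpExtension.decomp_not_le_kerSubgroup_of_isAnticyclotomic K p)
    (hBrA : ∀ (K : Type) [Field K] [NumberField K] (p : ℕ) [Fact p.Prime],
      ZpExtension.decomp_not_le_kerSubgroup_above_of_isAnticyclotomic K p)
    (hKo : ∀ (N : ℕ) [NeZero N] (W : WeierstrassCurve ℚ) (K : Type) [Field K] [NumberField K],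
      Literature.NumberTheory.EllipticCurves.kolyvagin N W K) :
    ∀ (W : WeierstrassCurve ℚ) [W.IsElliptic] [W.IsGloballyMinimal] (p : ℕ) [Fact p.Prime],
      W.analyticRank = 1 → p ≠ 2 → ClassX3 W p → Additive.SubSemistableTwist W p →
      ∀ (N : ℕ) [NeZero N] (K : Type) [Field K] [NumberField K]
        (Dt : ModularParametrizationData W N) (H : HeegnerDatum N (NumberField.discr K)) (ι : K →+* ℂ)
        (P : (W.baseChange K).toAffine.Point),
        W.analyticRank = 1 → Additive.N10.Locus W p → W.conductorNorm ℤ = N →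
        ∀ hK : IsImaginaryQuadratic K,
        Odd (NumberField.discr K) → ¬ p ∣ Units.torsionOrder K → SatisfiesHeegnerHypothesis N K →
        (W.quadraticTwist (NumberField.discr K : ℚ)).entireLFunction 1 ≠ 0 →
        WeierstrassCurve.Affine.Point.map ι.toRatAlgHom P = heegnerPointComplex Dt H →
        ¬ IsOfFinAddOrder P →
        ∀ (κ : ZpExtension K p), κ.IsAnticyclotomic →
          ∀ (γ : Field.absoluteGaloisGroup K) [Fact (κ.IsTopGenerator γ)]
            (𝔭 : HeightOneSpectrum (𝓞 K)) (h𝔭 : ((p : ℕ) : 𝓞 K) ∈ 𝔭.asIdeal)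
            (he : 𝔭.asIdeal.ramificationIdx (𝓞 ℚ) = 1) (hf : 𝔭.asIdeal.inertiaDeg (𝓞 ℚ) = 1),
            LocalTowerTorsionFiniteAt (W.baseChange K) p κ 𝔭 →
            AdditiveControlOnTreeAt p κ 𝔭 γ (embAt K p 𝔭 h𝔭 he hf) P := by
  intro W _ _ p _ hr hp2 hX hS N _ K _ _ Dt H ι P hr' hloc hN hK hodd hunit hHe hL1 hP hnt κ hκ γ _ 𝔭
    h𝔭 he hf hFin
  have hp : p.Prime := Fact.out
  haveI : IsTotallyComplex K := hK.2
  haveI hEK : (W.baseChange K).IsElliptic := by rw [baseChange]; infer_instance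
  have hpN : p ∣ W.conductorNorm ℤ := dvd_conductorNorm_of_n10Locus hloc
  have hsplit : SplitsIn K p := splitsIn_of_satisfiesHeegnerHypothesis hN hHe hpN
  obtain ⟨hrank, hSha⟩ := hKo N W K hK hHe ⟨Dt, H, ι, hP⟩ hnt
  -- `p^g = #E(K)[p^∞] = #E_K[p^∞]^{Γ_K} = #ker res`
  set g := padicValNat p (Nat.card (AddCommGroup.primaryComponent (W.baseChange K).toAffine.Point p))
    with hgdef
  have hcardg := natCard_primaryComponent_point_eq_pow (W.baseChange K) p
  haveI := finite_fixedPoints_kerSubgroup_of_not_dvd_torsionOrder W p κ hp2 hK hunit hκ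
  have hres : Nat.card ((W.baseChange K).resOfLe p (le_top : κ.kerSubgroup ≤ ⊤)).ker = p ^ g := by
    rw [natCard_ker_resOfLe_top_eq_natCard_fixedPoints (W.baseChange K) p κ,
      natCard_fixedPoints_geomPrimaryTorsion_eq_natCard_primaryComponent (W.baseChange K) p, hcardg]
  -- `t = t_p` from Fin_v and non-splitting above `p`
  obtain ⟨tp, htp⟩ := exists_natCard_primaryComponent_padic_eq_pow W p
  have h𝔭ker := natCard_localKer_eq_pow_of_finite W p κ 𝔭 h𝔭 he hf hFin (hBrA K p hK hp2 κ hκ 𝔭 h𝔭) htp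
  -- (P6-add-tors) at any `g`
  obtain ⟨hfin𝔭, a, hcard, ha⟩ := additiveBaseSelmerCountTors_of_rankOne_anyTorsion W p K (hPT K)
    (fun v ↦ localEulerPoincareCharacteristic_adicCompletionEP K v) hloc.2.1 hK hsplit hrank hSha P hnt
    𝔭 h𝔭 he hf
  have hcard' : Nat.card (selmerAcBase (W.baseChange K) p 𝔭 ∅) * p ^ tp = p ^ a := by
    rw [← htp]; exact hcard
  have hle : tp ≤ a :=
    (Nat.pow_dvd_pow_iff_le_right hp.one_lt).mp ⟨_, by rw [mul_comm]; exact hcard'.symm⟩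
  have hcardSel : Nat.card (selmerAcBase (W.baseChange K) p 𝔭 ∅) = p ^ (a - tp) := by
    have hsplitpow : p ^ a = p ^ (a - tp) * p ^ tp := by rw [← pow_add, Nat.sub_add_cancel hle]
    rw [hsplitpow] at hcard'
    exact Nat.eq_of_mul_eq_mul_right (pow_pos hp.pos tp) hcard'
  -- gen 0's torsion-robust glue
  refine additiveControlOnTreeAt_of_torsAtoms (W := W) hK hsplit hpN hκ γ 𝔭 h𝔭 (embAt K p 𝔭 h𝔭 he hf)
    P g tp (a - tp) hres h𝔭ker ⟨⟨hfin𝔭, hcardSel⟩, ?_⟩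
    (stub_ptSurj_of_poitouTate hPT hKo W p hr hp2 hX hS N K Dt H ι P hr' hloc hN hK hodd hunit hHe hL1
      hP hnt κ hκ γ 𝔭 h𝔭 he hf)
    (stub_coinv_of_poitouTate hPT hPT2 hKo W p hr hp2 hX hS N K Dt H ι P hr' hloc hN hK hodd hunit hHe
      hL1 hP hnt κ hκ γ 𝔭 h𝔭 he hf)
    (r1LocalKernelOrderAt_of_anticyclotomicDecomposition (W := W) (p := p) hBr hp2 K hK κ hκ)
  rw [Nat.cast_sub hle, ha]

/-- **Item `ControlGlobalPTorsionF` of route `SchneiderFreeAdditiveX3` holds** (stmt-BirchSwinnertonDyer-19547,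
regime B2 of the control corner: the frames WITH global `p`-torsion, `E(K)[p] ≠ 0` — `p = 3`, the
`3`-torsion members of the door's X3 classes — GIVEN Fin_v on the cell): by
`additiveControlOnTreeAt_anyTorsion_of_facts`, which does not even use `E(K)[p] ≠ 0` (the count is
uniform in `g`). This is the registered stub `stub_regimeB2` of the v4-KF skeleton of crux
`AnticycControlAdditiveKF` (stmt-BirchSwinnertonDyer-19548). CONDITIONAL on the cited facts that are
antecedents of the statement itself; closes nothing about BSD by itself.
[cite: JetchevSkinnerWan2017, Thm. 3.3.1 (arXiv:1512.06894 p. 11)] [cite: KellerYin2024, App. B Thm. B.0.6 (arXiv:2402.12781 pp. 29–30)]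
[cite: MilneADT2006, Ch. I, Thm. 4.10 and Thm. 2.8] [cite: Brink2007, Thm. 2 and Cor. 1] [cite: Kolyvagin1990, Thm. A] -/
theorem controlGlobalPTorsionF_holds :
    Summit.BirchSwinnertonDyer.BirchSwinnertonDyer.Theses.SchneiderFreeAdditiveX3.ControlGlobalPTorsionF := by
  intro hPT hPT2 hBr hBrA hKo W _ _ p _ hr hp2 hX hS hFinV N _ K _ _ Dt H ι P hr' hloc hN hK hodd hunit
    hHe hL1 hP hnt κ hκ γ _ 𝔭 h𝔭 he hf _
  have hpN : p ∣ W.conductorNorm ℤ := dvd_conductorNorm_of_n10Locus hloc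
  have hsplit : SplitsIn K p := splitsIn_of_satisfiesHeegnerHypothesis hN hHe hpN
  exact additiveControlOnTreeAt_anyTorsion_of_facts hPT hPT2 hBr hBrA hKo W p hr hp2 hX hS N K Dt H ι P
    hr' hloc hN hK hodd hunit hHe hL1 hP hnt κ hκ γ 𝔭 h𝔭 he hf (hFinV K hK hsplit κ hκ 𝔭 h𝔭)

/-- The registered stub `stub_regimeB2` of the v4-KF skeleton (crux `AnticycControlAdditiveKF`,
stmt-BirchSwinnertonDyer-19548), which is the item BY NAME. [folklore] -/
theorem stub_regimeB2 :
    Summit.BirchSwinnertonDyer.BirchSwinnertonDyer.Theses.SchneiderFreeAdditiveX3.ControlGlobalPTorsionF :=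
  controlGlobalPTorsionF_holds

end RegimeB2

end Summit.BirchSwinnertonDyer.BirchSwinnertonDyer.Theorems.SchneiderFreeAdditiveX3

end
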